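import Mathlib
import Summits.QuantumFields.YangMills.Theses.MagneticFluxCeiling
import Literature.MathematicalPhysics.QuantumFieldTheory.AnisotropicTwistedPartitionFunction
import Literature.MathematicalPhysics.QuantumFieldTheory.WilsonFinTorusMagneticSliceKernel
import HarnessLib

/-!
# The spectral sandwich of route `MagneticFluxCeiling` (support item stmt-QuantumFields-25309, closed by name)

`SpectralSandwich`: for `SU(N)`, `N ≥ 2`, a lattice representation `r`, `β > 0`, central `z`, a side `L ≥ 2` and constants
`C, K, M₀`: if `log [Z_z(L³×M)/Z_1(L³×M)] ≥ −C·M/L − K` for all `M ≥ M₀` (twist `z` in the spatial plane `q₀ = (0,1)`), then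
`e^{−C} · Z(L³×2L)/Z(L⁴)² ≤ Z_z(L⁴)/Z_1(L⁴)`.

Proof (exact transfer-matrix bookkeeping, no Perron–Frobenius beyond the existence of a top level): by the magnetic-sector
trace formula (`exists_spectralData_wilsonFinTorusTensorTwistedPartition_magnetic`, applied to the tensor `planeTwistTensor z q₀`,
whose electric part is trivial, and to `z = 1`) `Z_z(L³×(m+2)) = Σⱼ μⱼ^{m+2}` and `Z_1(L³×(m+2)) = Σᵢ λᵢ^{m+2}` with
`0 ≤ μⱼ ≤ μ₀`, `0 ≤ λᵢ ≤ λ₀`, `0 < μ₀, λ₀`.  Hence `Z_z(m+2) ≤ μ₀^m Z_z(2)` and `Z_1(m+2) ≥ λ₀^{m+2}`, so the hypothesis at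
`M = m + 2` gives `m · (log μ₀ − log λ₀ + C/L) ≥ const` for all large `m`, whence `log μ₀ ≥ log λ₀ − C/L` (no limit is taken).
Then `Z_z(L⁴) ≥ μ₀^L ≥ e^{−C} λ₀^L ≥ e^{−C} · Z(L³×2L)/Z(L⁴)` because `Σ λᵢ^{2L} ≤ λ₀^L Σ λᵢ^L`, and one divides by `Z(L⁴) = Z_1(L⁴)`.
No summit is proved: a finite-box identity-level bound; the Yang–Mills mass gap is NOT proved.
-/

noncomputable section

open MeasureTheory Filter Topology Function
open Literature.MathematicalPhysics.QuantumFieldTheory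

namespace Summit.QuantumFields.YangMills.Theorems.MagneticFluxCeiling

/-! ### Power-sum bookkeeping for one box and one spatial twist -/

section General

variable {G : Type*} [Group G] [TopologicalSpace G] [IsTopologicalGroup G] [CompactSpace G]
  [MeasurableSpace G] [BorelSpace G] [SecondCountableTopology G] {N : ℕ} (ρ : G →* Matrix (Fin N) (Fin N) ℂ)

omit [TopologicalSpace G] [IsTopologicalGroup G] [CompactSpace G] [MeasurableSpace G] [BorelSpace G]
  [SecondCountableTopology G] in
/-- The spatial plane `q₀ = (0, 1)` of the route's statements: its twist tensor has trivial electric part. [problem-side] -/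
theorem planeTwistTensor_q0_castSucc_three (z : G) (i : Fin 3) :
    planeTwistTensor z ⟨((0 : Fin 4), (1 : Fin 4)), by decide⟩ i.castSucc 3 = 1 :=
  planeTwistTensor_of_ne z _ (by simp)

/-- **Spectral bookkeeping of a spatially twisted box** `L_s³ × (m+2)`, twist tensor `planeTwistTensor z q₀` (trivial electric
part): there is a top level `μ₀ > 0` with `μ₀^{m+2} ≤ Z_z(m+2) ≤ μ₀^m · Z_z(2)` for every `m`. [problem-side] -/
theorem exists_topLevel_twisted (hρ : Continuous ρ) (hρu : ∀ g, ρ g ∈ Matrix.unitaryGroup (Fin N) ℂ) {β : ℝ} (hβ : 0 ≤ β)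
    (z : G) (Ls : ℕ) :
    ∃ μ₀ : ℝ, 0 < μ₀ ∧
      (∀ m : ℕ, μ₀ ^ (m + 2) ≤ twistedPartitionFunctionAniso ρ β Ls (m + 2) z ⟨((0 : Fin 4), (1 : Fin 4)), by decide⟩) ∧
      (∀ m : ℕ, twistedPartitionFunctionAniso ρ β Ls (m + 2) z ⟨((0 : Fin 4), (1 : Fin 4)), by decide⟩ ≤
        μ₀ ^ m * twistedPartitionFunctionAniso ρ β Ls 2 z ⟨((0 : Fin 4), (1 : Fin 4)), by decide⟩) := by
  obtain ⟨s, hcnt, lam, i₀, hlam, hpos, -, hZ⟩ :=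
    exists_spectralData_wilsonFinTorusTensorTwistedPartition_magnetic (ρ := ρ) hρ hρu hβ
      (z := planeTwistTensor z ⟨((0 : Fin 4), (1 : Fin 4)), by decide⟩) (planeTwistTensor_q0_castSucc_three z) Ls Ls Ls
  haveI : Countable s := hcnt
  have hZ' : ∀ m : ℕ, HasSum (fun i => lam i ^ (m + 2))
      (twistedPartitionFunctionAniso ρ β Ls (m + 2) z ⟨((0 : Fin 4), (1 : Fin 4)), by decide⟩) := fun m => by
    rw [twistedPartitionFunctionAniso_def]; exact hZ m
  refine ⟨lam i₀, hpos, fun m => ?_, fun m => ?_⟩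
  · exact le_hasSum (hZ' m) i₀ fun j _ => pow_nonneg (hlam j).1 _
  · have h2 : HasSum (fun i => lam i₀ ^ m * lam i ^ (0 + 2))
        (lam i₀ ^ m * twistedPartitionFunctionAniso ρ β Ls 2 z ⟨((0 : Fin 4), (1 : Fin 4)), by decide⟩) :=
      (hZ' 0).mul_left _
    refine hasSum_le (fun i => ?_) (hZ' m) h2
    calc lam i ^ (m + 2) = lam i ^ m * lam i ^ (0 + 2) := by ring
      _ ≤ lam i₀ ^ m * lam i ^ (0 + 2) :=
          mul_le_mul_of_nonneg_right (pow_le_pow_left₀ (hlam i).1 (hlam i).2 m) (pow_nonneg (hlam i).1 _)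

/-- **Spectral bookkeeping of the untwisted box** `L_s³ × (m+2)`: a top level `λ₀ > 0` with `λ₀^{m+2} ≤ Z(m+2)` for every `m` and
the aspect comparison `Z(L_s³ × (2l+4)) ≤ λ₀^{l+2} · Z(L_s³ × (l+2))` (`Σ λᵢ^{2L} ≤ λ₀^L Σ λᵢ^L`). [problem-side] -/
theorem exists_topLevel_untwisted (hρ : Continuous ρ) (hρu : ∀ g, ρ g ∈ Matrix.unitaryGroup (Fin N) ℂ) {β : ℝ} (hβ : 0 ≤ β)
    (Ls : ℕ) :
    ∃ lam₀ : ℝ, 0 < lam₀ ∧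
      (∀ m : ℕ, lam₀ ^ (m + 2) ≤ wilsonFinTorusPartition ρ β Ls Ls Ls (m + 2)) ∧
      (∀ l : ℕ, wilsonFinTorusPartition ρ β Ls Ls Ls (2 * l + 2 + 2) ≤
        lam₀ ^ (l + 2) * wilsonFinTorusPartition ρ β Ls Ls Ls (l + 2)) := by
  obtain ⟨s, hcnt, lam, i₀, hlam, hpos, -, hZ⟩ :=
    exists_spectralData_wilsonFinTorusTensorTwistedPartition_magnetic (ρ := ρ) hρ hρu hβ
      (z := planeTwistTensor (1 : G) ⟨((0 : Fin 4), (1 : Fin 4)), by decide⟩) (planeTwistTensor_q0_castSucc_three (1 : G))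
      Ls Ls Ls
  haveI : Countable s := hcnt
  have hZ' : ∀ m : ℕ, HasSum (fun i => lam i ^ (m + 2)) (wilsonFinTorusPartition ρ β Ls Ls Ls (m + 2)) := fun m => by
    rw [← twistedPartitionFunctionAniso_one ρ β Ls (m + 2) ⟨((0 : Fin 4), (1 : Fin 4)), by decide⟩,
      twistedPartitionFunctionAniso_def]
    exact hZ m
  refine ⟨lam i₀, hpos, fun m => ?_, fun l => ?_⟩
  · exact le_hasSum (hZ' m) i₀ fun j _ => pow_nonneg (hlam j).1 _
  · have h2 : HasSum (fun i => lam i₀ ^ (l + 2) * lam i ^ (l + 2))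
        (lam i₀ ^ (l + 2) * wilsonFinTorusPartition ρ β Ls Ls Ls (l + 2)) := (hZ' l).mul_left _
    have h1 : HasSum (fun i => lam i ^ (2 * l + 2 + 2)) (wilsonFinTorusPartition ρ β Ls Ls Ls (2 * l + 2 + 2)) :=
      hZ' (2 * l + 2)
    refine hasSum_le (fun i => ?_) h1 h2
    calc lam i ^ (2 * l + 2 + 2) = lam i ^ (l + 2) * lam i ^ (l + 2) := by ring
      _ ≤ lam i₀ ^ (l + 2) * lam i ^ (l + 2) :=
          mul_le_mul_of_nonneg_right (pow_le_pow_left₀ (hlam i).1 (hlam i).2 _) (pow_nonneg (hlam i).1 _)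

/-- **From the Coulomb-type hypothesis to the top levels** (no limit taken): if `−C·M/L − K ≤ log (Z_z(M)/Z_1(M))` for all
`M ≥ M₀`, then `log μ₀ − log λ₀ + C/L ≥ 0` for the top levels of the two boxes. [problem-side] -/
theorem log_topLevel_ge (hρ : Continuous ρ) {β : ℝ} (z : G) {Ls : ℕ} {C K : ℝ} {M₀ : ℕ}
    (hyp : ∀ M : ℕ, M₀ ≤ M → -C * (M : ℝ) / (Ls : ℝ) - K ≤
      Real.log (twistedPartitionFunctionAniso ρ β Ls M z ⟨((0 : Fin 4), (1 : Fin 4)), by decide⟩ /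
        twistedPartitionFunctionAniso ρ β Ls M 1 ⟨((0 : Fin 4), (1 : Fin 4)), by decide⟩))
    {μ₀ lam₀ : ℝ} (hμ : 0 < μ₀) (hlam : 0 < lam₀)
    (hup : ∀ m : ℕ, twistedPartitionFunctionAniso ρ β Ls (m + 2) z ⟨((0 : Fin 4), (1 : Fin 4)), by decide⟩ ≤
      μ₀ ^ m * twistedPartitionFunctionAniso ρ β Ls 2 z ⟨((0 : Fin 4), (1 : Fin 4)), by decide⟩)
    (hlow : ∀ m : ℕ, lam₀ ^ (m + 2) ≤ wilsonFinTorusPartition ρ β Ls Ls Ls (m + 2)) :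
    0 ≤ Real.log μ₀ - Real.log lam₀ + C / (Ls : ℝ) := by
  set q₀ : {p : Fin 4 × Fin 4 // p.1 < p.2} := ⟨((0 : Fin 4), (1 : Fin 4)), by decide⟩ with hq₀
  set a : ℝ := Real.log μ₀ - Real.log lam₀ + C / (Ls : ℝ) with ha
  set Z2 : ℝ := twistedPartitionFunctionAniso ρ β Ls 2 z q₀ with hZ2
  have hZ2pos : 0 < Z2 := twistedPartitionFunctionAniso_pos ρ hρ β Ls 2 z q₀
  -- the linear inequality `m · a ≥ B` for all `m ≥ M₀`
  set B : ℝ := 2 * Real.log lam₀ - Real.log Z2 - 2 * C / (Ls : ℝ) - K with hB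
  have hlin : ∀ m : ℕ, M₀ ≤ m → B ≤ (m : ℝ) * a := by
    intro m hm
    have h := hyp (m + 2) (by omega)
    have hZz : 0 < twistedPartitionFunctionAniso ρ β Ls (m + 2) z q₀ := twistedPartitionFunctionAniso_pos ρ hρ β Ls _ z q₀
    have hZ1 : 0 < twistedPartitionFunctionAniso ρ β Ls (m + 2) 1 q₀ := twistedPartitionFunctionAniso_pos ρ hρ β Ls _ 1 q₀
    rw [Real.log_div hZz.ne' hZ1.ne'] at h
    -- upper bound on `log Z_z(m+2)` and lower bound on `log Z_1(m+2)`
    have hu : Real.log (twistedPartitionFunctionAniso ρ β Ls (m + 2) z q₀) ≤ (m : ℝ) * Real.log μ₀ + Real.log Z2 := by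
      have h1 := Real.log_le_log hZz (hup m)
      rw [Real.log_mul (pow_pos hμ m).ne' hZ2pos.ne', Real.log_pow] at h1
      exact h1
    have hl : ((m : ℝ) + 2) * Real.log lam₀ ≤ Real.log (twistedPartitionFunctionAniso ρ β Ls (m + 2) 1 q₀) := by
      have h1 := Real.log_le_log (pow_pos hlam (m + 2)) (hlow m)
      rw [Real.log_pow] at h1
      push_cast at h1
      rw [twistedPartitionFunctionAniso_one]
      exact h1
    have hcast : ((m + 2 : ℕ) : ℝ) = (m : ℝ) + 2 := by push_cast; ring
    rw [hcast] at h
    have : -C * ((m : ℝ) + 2) / (Ls : ℝ) - K ≤ (m : ℝ) * Real.log μ₀ + Real.log Z2 - ((m : ℝ) + 2) * Real.log lam₀ := by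
      linarith
    rw [hB, ha]
    have hsplit : -C * ((m : ℝ) + 2) / (Ls : ℝ) = -(m : ℝ) * (C / (Ls : ℝ)) - 2 * C / (Ls : ℝ) := by ring
    rw [hsplit] at this
    linarith
  -- a negative slope is impossible
  by_contra hneg
  rw [not_le] at hneg
  obtain ⟨m, hm⟩ := exists_nat_gt ((B / a) ⊔ (M₀ : ℝ))
  have hmM : M₀ ≤ m := by exact_mod_cast ((le_sup_right).trans hm.le)
  have h1 := hlin m hmM
  have h2 : B / a < (m : ℝ) := (le_sup_left).trans_lt hm
  rw [div_lt_iff_of_neg hneg] at h2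
  linarith

end General

/-- **`SpectralSandwich` (stmt-QuantumFields-25309), by name.** [problem-side] -/
theorem spectralSandwich_proof : Summit.QuantumFields.YangMills.Theses.MagneticFluxCeiling.SpectralSandwich := by
  intro N _ r β hβ z _ L hL C K M₀ hyp
  set q₀ : {p : Fin 4 × Fin 4 // p.1 < p.2} := ⟨((0 : Fin 4), (1 : Fin 4)), by decide⟩ with hq₀
  have hρ := r.continuous
  have hρu := r.mem_unitary
  obtain ⟨μ₀, hμ, hμlow, hμup⟩ := exists_topLevel_twisted r.ρ hρ hρu hβ.le z L
  obtain ⟨lam₀, hlam, hlow, haspect⟩ := exists_topLevel_untwisted r.ρ hρ hρu hβ.le L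
  have ha := log_topLevel_ge r.ρ hρ z hyp hμ hlam hμup hlow
  obtain ⟨l, rfl⟩ : ∃ l, L = l + 2 := ⟨L - 2, by omega⟩
  have hLpos : (0 : ℝ) < ((l + 2 : ℕ) : ℝ) := by positivity
  -- `μ₀^L ≥ e^{-C} λ₀^L`
  have hlev : Real.exp (-C) * lam₀ ^ (l + 2) ≤ μ₀ ^ (l + 2) := by
    have h1 : Real.log lam₀ - C / ((l + 2 : ℕ) : ℝ) ≤ Real.log μ₀ := by linarith
    have h2 : ((l + 2 : ℕ) : ℝ) * (Real.log lam₀ - C / ((l + 2 : ℕ) : ℝ)) ≤ ((l + 2 : ℕ) : ℝ) * Real.log μ₀ :=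
      mul_le_mul_of_nonneg_left h1 hLpos.le
    have h3 : ((l + 2 : ℕ) : ℝ) * (Real.log lam₀ - C / ((l + 2 : ℕ) : ℝ)) = ((l + 2 : ℕ) : ℝ) * Real.log lam₀ - C := by
      field_simp
    rw [h3] at h2
    have h4 := Real.exp_le_exp.2 h2
    rw [Real.exp_sub, ← Real.log_pow, ← Real.log_pow, Real.exp_log (pow_pos hlam _), Real.exp_log (pow_pos hμ _)] at h4
    rw [div_le_iff₀ (Real.exp_pos C)] at h4
    calc Real.exp (-C) * lam₀ ^ (l + 2) = lam₀ ^ (l + 2) / Real.exp C := by rw [Real.exp_neg]; ring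
      _ ≤ μ₀ ^ (l + 2) := by rw [div_le_iff₀ (Real.exp_pos C)]; exact h4
  -- the chain
  have hZpos : 0 < wilsonFinTorusPartition r.ρ β (l + 2) (l + 2) (l + 2) (l + 2) := by
    rw [← twistedPartitionFunctionAniso_one r.ρ β (l + 2) (l + 2) q₀]
    exact twistedPartitionFunctionAniso_pos r.ρ hρ β _ _ 1 q₀
  have h2L : 2 * (l + 2) = 2 * l + 2 + 2 := by ring
  rw [twistedPartitionFunctionAniso_one, h2L, div_le_div_iff₀ (by positivity) hZpos, sq]
  calc Real.exp (-C) * wilsonFinTorusPartition r.ρ β (l + 2) (l + 2) (l + 2) (2 * l + 2 + 2) *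
        wilsonFinTorusPartition r.ρ β (l + 2) (l + 2) (l + 2) (l + 2)
      ≤ Real.exp (-C) * (lam₀ ^ (l + 2) * wilsonFinTorusPartition r.ρ β (l + 2) (l + 2) (l + 2) (l + 2)) *
          wilsonFinTorusPartition r.ρ β (l + 2) (l + 2) (l + 2) (l + 2) := by
        gcongr
        exact haspect l
    _ = Real.exp (-C) * lam₀ ^ (l + 2) * (wilsonFinTorusPartition r.ρ β (l + 2) (l + 2) (l + 2) (l + 2) *
          wilsonFinTorusPartition r.ρ β (l + 2) (l + 2) (l + 2) (l + 2)) := by ring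
    _ ≤ μ₀ ^ (l + 2) * (wilsonFinTorusPartition r.ρ β (l + 2) (l + 2) (l + 2) (l + 2) *
          wilsonFinTorusPartition r.ρ β (l + 2) (l + 2) (l + 2) (l + 2)) :=
        mul_le_mul_of_nonneg_right hlev (by positivity)
    _ ≤ twistedPartitionFunctionAniso r.ρ β (l + 2) (l + 2) z q₀ *
          (wilsonFinTorusPartition r.ρ β (l + 2) (l + 2) (l + 2) (l + 2) *
            wilsonFinTorusPartition r.ρ β (l + 2) (l + 2) (l + 2) (l + 2)) :=
        mul_le_mul_of_nonneg_right (hμlow l) (by positivity)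

end Summit.QuantumFields.YangMills.Theorems.MagneticFluxCeiling

end
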